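import Mathlib
import Summits.QuantumFields.YangMills.Theses.MirrorModularBoosts
import Literature.MathematicalPhysics.QuantumFieldTheory.OSSectorContinuation
import Literature.MathematicalPhysics.QuantumFieldTheory.OSReconstructionNoE1Proofs

/-!
# Line `two-mirror-lightcone-slots` for crux `MirrorModularBoosts.PlanarSpectralCone` (stmt-QuantumFields-9664)

Lead prover's skeleton (prover-line-stmt-QuantumFields-9664-0, 2026-08-15), RESHAPED from the planner's
`Lines/two-mirror-lightcone-slots.lean` (planner-cruxplan-stmt-QuantumFields-9664-two-mirror-lightcone-0):
same line (the two DIAGONAL OS semigroups are the two slots of the tree's k = 1 sector engine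
`LogSlot.IsSectorData`; back end disc ⇒ exponential moments ⇒ t-uniform ray bounds ⇒ cone support of the
e₀ joint spectral measure; density of cone-chain vectors; transfer C⁺ ⇒ C), with three cuts re-typed for Lean:

* the FRONT END is split into `stub_coneChainFrames` (pure geometry: cone chains are diagonal-frame OS pairs,
  `θRθ = R⁻¹` for the ±45° frames) and `stub_complexTimeSlot` (generic analysis: the complex-time matrix
  element `⟪ψ, e^{-τH}U(a⃗)ψ'⟫` of ANY `OSReconstructionNoE1`, from polarised joint spectral measures),
  assembled into `LogSlot.IsSectorData` by the glue `coneSectorData` below;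
* the BACK END is cut as in line `positivity-disc-to-operator-cone`: `stub_discSections_of_sectorExtension`
  (Thales: the ζ = t slice of the sector region is the disc `|β| < t`, plus the e₀ read-back) and the pure
  measure-theoretic lever `stub_cone_of_discSections` (Lukacs/Landau–Pringsheim + ray asymptotics, delay 0);
* CLOSURE is the generic `stub_linearity` of line `positivity-disc-to-operator-cone` (null sets of ALL joint
  spectral measures pass from a set of dense span to every vector: Laplace–Fourier uniqueness of joint spectral
  measures + parallelogram inequality), so that the TRANSFER `stub_contractionFamily` takes the GLOBAL cone
  hypothesis (operator cone `H ≥ |P₁|`) and returns the abstract contraction family;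
* DENSITY `stub_coneChain_dense` is unchanged (hardest; held by the lead).

Notation in comments. `e₀ = EuclideanSpace.single 0 1`, `e₁ = EuclideanSpace.single 1 1`, `n = (e₀+e₁)/√2`,
`n' = (e₀−e₁)/√2`, light-cone point `a(u,u') = u n + u' n' = ((u+u')/√2) e₀ + ((u−u')/√2) e₁`; a test
function `G` is a CONE CHAIN if `tsupport G ⊆ {x | ∀ i, |xᵢ¹| < xᵢ⁰ ∧ ∀ i<j, |xⱼ¹ − xᵢ¹| < xⱼ⁰ − xᵢ⁰}`;
`φ_G(u,u') = 𝔖_{2m}(ΘG* ⊗ G_{a(u,u')})`; `h` = the e₀-frame `OSReconstructionNoE1` of `S.toLabelled`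
(`Ψ_G = h.fieldVec`, `e^{-tH} = h.transfer t`, `U(a⃗) = h.translate a`, `h.IsJointSpectralMeasure`);
`D = {(ζ,β) : |Im β| < Re ζ}` is the crux's domain.

Disproof.lean (cdisprove v1–v3) is not mounted on this hub; read through its evidence notes:
`false_without_diagonalFrames` honoured at `stub_coneChainFrames` (the only consumer of the diagonal frames),
`false_without_translation` at `stub_coneChainFrames` (pulled-back reconstructions) and in `h`,
`false_without_axisFrames` in `h` (Step 0); `cross_slice_iff_disc` is why the back end goes disc → moments →
rays; `cone_of_laplace_bound` is the last step of `stub_cone_of_discSections`; `crux_at_zero`/`crux_at_vacuumOnly`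
pass (Φ constant).
-/

noncomputable section

namespace Summit.QuantumFields.YangMills.Cruxes.PlanarSpectralCone.TwoMirrorLightconeSlots

open MeasureTheory Complex Set Filter
open scoped InnerProductSpace ComplexConjugate
open Literature.MathematicalPhysics.QuantumLattice Literature.MathematicalPhysics.AQFT
  Literature.MathematicalPhysics.QuantumFieldTheory
open Summit.QuantumFields.YangMills.Theses.MirrorModularBoosts

set_option linter.unusedVariables false
set_option linter.dupNamespace false

local notation "E4" => EuclideanSpace ℝ (Fin 4)

/-! ## The seven stubs -/

/-- **FRONT END, geometry — cone chains are diagonal-frame OS pairs (M).** For `S` translation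
invariant on `⁰𝒮` with the crux's eight-frame pull-back RP and a cone chain `G`, there are two frames
`R₊, R₋ : ℝ⁴ ≃ₗᵢ ℝ⁴` (the rotations by `±45°` of the `(x₀,x₁)`-plane, `R₊e₀ = n`, `R₋e₀ = n'`) whose
pulled-back families `S ∘ linActMulti R±` satisfy the premises of `OSReconstructionNoE1` (E2 = the frame
hypothesis at `(a,b) = (1/√2, ±1/√2)`; translation invariance on `⁰𝒮` transported by
`linActMulti_translateMulti`, isometries preserve `IsOffDiagonal`), and e₀-time-ordered `A±, B±` with the
Schwartz-map identities `ΘG* ⊗ G_{a(u,u')} = linActMulti R₊ (ΘA₊* ⊗ (B₊)_{u e₀ − u' e₁})` and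
`ΘG* ⊗ G_{a(u,u')} = linActMulti R₋ (ΘA₋* ⊗ (B₋)_{u' e₀ + u e₁})` for all real `u, u'`.
Why true: `linActMulti R X (x) = X(R⁻¹x)`, `linActMulti_appendTensor`, `linActMulti_translateMulti`; with
`A± = linActMulti R± G`, `B± = linActMulti R±⁻¹ G` one has `osAdjoint A± = linActMulti R±⁻¹ (osAdjoint G)`
because `θ R± θ = R±⁻¹` (conjugating a plane rotation by the reflection of one of its axes inverts it);
`R₊⁻¹ a(u,u') = u e₀ − u' e₁`, `R₋⁻¹ a(u,u') = u' e₀ + u e₁`; a cone chain is ordered along `n` and `n'`, so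
`A±, B±` are e₀-time-ordered (`(R₊x)·e₀ = x·n'`, `(R₊⁻¹x)·e₀ = x·n`). Size M (a 45° `LinearIsometryEquiv` of
`EuclideanSpace ℝ (Fin 4)`, support bookkeeping under `linActMulti`, two `OSReconstructionNoE1` packages). -/
theorem stub_coneChainFrames
    (S : SchwingerFamily E4)
    (hT : ∀ (n : ℕ) (a : E4) (F : SchwartzMap (Fin n → E4) ℂ), IsOffDiagonal F →
      S n (translateMulti a F) = S n F)
    (hRP : ∀ (R : E4 ≃ₗᵢ[ℝ] E4) (a b : ℝ), a ^ 2 + b ^ 2 = 1 → (a = 0 ∨ b = 0 ∨ a ^ 2 = b ^ 2) →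
      R (EuclideanSpace.single 0 1) = a • EuclideanSpace.single 0 1 + b • EuclideanSpace.single 1 1 →
      (SchwingerFamily.toLabelled (fun n => (S n).comp (linActMulti R))).IsReflectionPositive)
    {m : ℕ} (G : SchwartzMap (Fin m → E4) ℂ)
    (hGcone : tsupport (G : (Fin m → E4) → ℂ) ⊆
      {x | (∀ i, |x i 1| < x i 0) ∧ ∀ i j, i < j → |x j 1 - x i 1| < x j 0 - x i 0}) :
    ∃ (Rp Rm : E4 ≃ₗᵢ[ℝ] E4) (Ap Bp Am Bm : SchwartzMap (Fin m → E4) ℂ),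
      IsTimeOrdered Ap ∧ IsTimeOrdered Bp ∧ IsTimeOrdered Am ∧ IsTimeOrdered Bm ∧
      OSReconstructionNoE1 (SchwingerFamily.toLabelled (fun k => (S k).comp (linActMulti Rp))) ∧
      OSReconstructionNoE1 (SchwingerFamily.toLabelled (fun k => (S k).comp (linActMulti Rm))) ∧
      (∀ u u' : ℝ, (osAdjoint G).appendTensor
          (translateMulti (((u + u') / Real.sqrt 2) • EuclideanSpace.single 0 1 +
            ((u - u') / Real.sqrt 2) • EuclideanSpace.single 1 1) G) =
        linActMulti Rp ((osAdjoint Ap).appendTensor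
          (translateMulti (u • EuclideanSpace.single 0 1 + (-u') • EuclideanSpace.single 1 1) Bp))) ∧
      (∀ u u' : ℝ, (osAdjoint G).appendTensor
          (translateMulti (((u + u') / Real.sqrt 2) • EuclideanSpace.single 0 1 +
            ((u - u') / Real.sqrt 2) • EuclideanSpace.single 1 1) G) =
        linActMulti Rm ((osAdjoint Am).appendTensor
          (translateMulti (u' • EuclideanSpace.single 0 1 + u • EuclideanSpace.single 1 1) Bm))) := by
  sorry

/-- **FRONT END, analysis — complex-time matrix elements (M).** For ANY labelled family `T` on `ℝ⁴` with
E2 + translations on `⁰𝒮` (`h : OSReconstructionNoE1 T`) and vectors `ψ, ψ'`, the matrix element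
`⟪ψ, e^{-xH} U(a⃗) ψ'⟫` (`x > 0`, `a` spatial) is the restriction to the positive axis of a function
`E a τ` holomorphic in `τ` on the right half-plane, continuous in `a ∈ ℝ⁴`, and bounded by one constant.
Why true: polarise over the four vectors `χₖ = ψ + iᵏψ'` and put
`E a τ = ¼ Σₖ (−i)ᵏ ∫ e^{−τ p₀ + i⟨a,p⟩} dμₖ` with `μₖ` a joint spectral measure of `χₖ`
(`exists_isJointSpectralMeasure_holds`, PROVED): each integral converges absolutely for `Re τ ≥ 0`
(`μₖ{p₀ < 0} = 0`, finite mass `‖χₖ‖²`), is holomorphic on `Re τ > 0` (dominated differentiation,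
`p₀ e^{−δp₀}` bounded) and continuous in `a` (dominated convergence), with `|·| ≤ ‖χₖ‖²`; at real `τ = x > 0`
and spatial `a` it is `⟪χₖ, e^{-xH}U(a⃗)χₖ⟫` (`IsJointSpectralMeasure.inner_transfer_translate`), and the
polarisation identity (`inner_map_polarization'` for the linear map `e^{-xH}U(a⃗)`) gives `⟪ψ, e^{-xH}U(a⃗)ψ'⟫`;
`C = ‖ψ‖² + ‖ψ'‖²` works (parallelogram law). Size M. -/
theorem stub_complexTimeSlot
    {ι : Type} {T : LabelledSchwingerFamily ι E4} (h : OSReconstructionNoE1 T) (ψ ψ' : h.Hilbert) :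
    ∃ (C : ℝ) (E : E4 → ℂ → ℂ),
      (∀ a : E4, DifferentiableOn ℂ (E a) {τ : ℂ | 0 < τ.re}) ∧
      (∀ τ : ℂ, 0 < τ.re → Continuous fun a : E4 => E a τ) ∧
      (∀ (a : E4) (τ : ℂ), 0 < τ.re → ‖E a τ‖ ≤ C) ∧
      (∀ a : E4, a 0 = 0 → ∀ x : ℝ, 0 < x →
        E a (x : ℂ) = ⟪ψ, h.transfer x (h.translate a ψ')⟫_ℂ) := by
  sorry

/-- **BACK END, first half — a bounded sector extension gives disc sections (Thales; S/M).** In the e₀-frame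
reconstruction `h` of `S`, let `G` be time-ordered and let `Φ` be holomorphic on the two-slot sector region
`{Re u, Re u' > 0, |arg u| + |arg u'| < π/2}`, bounded by `M` there, and equal to `φ_G` on the open quadrant.
Then for every `t > 0` the function `f(β) = Φ((t+β)/√2, (t−β)/√2)` is holomorphic on the disc `|β| < t`,
bounded by `M`, and equals `⟪Ψ_G, e^{-tH} U(b e₁) Ψ_G⟫` at real `|b| < t`.
Why true: for complex `|β| < t` both `(t ± β)/√2` have positive real part and
`|arg((t+β)/√2)| + |arg((t−β)/√2)| < π/2` (`arg = arctan(Im/Re)`; `arctan x + arctan y < π/2 ⇔ xy < 1` for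
`x, y ≥ 0`; here `σ²/((t+b)(t−b)) < 1 ⇔ b² + σ² < t²` — the disc; TRIAGE-r1-3-Thales.lean proves the `β = iσ`
case, cdisprove `cross_slice_iff_disc` the disc), so the affine map lands in the sector region (composition of
`DifferentiableOn`); at real `b` the point is real with `u + u' = √2 t`, `u − u' = √2 b`, and
`φ_G(u,u') = 𝔖_{2m}(ΘG* ⊗ G_{te₀+be₁}) = ⟪Ψ_G, e^{-tH}U(be₁)Ψ_G⟫` (`inner_fieldVec_fieldVec`, `transfer_fieldVec`,
`translate_fieldVec`, `translateMulti_translateMulti`, `timeVec t + spatialPart 0 (b e₁) = t e₀ + b e₁`). Size S/M. -/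
theorem stub_discSections_of_sectorExtension
    (S : SchwingerFamily E4) (h : OSReconstructionNoE1 S.toLabelled)
    {m : ℕ} (G : SchwartzMap (Fin m → E4) ℂ) (hG : IsTimeOrdered G)
    (M : ℝ) (Φ : (Fin 2 → ℂ) → ℂ)
    (hΦd : DifferentiableOn ℂ Φ (Literature.Analysis.Complex.sectorRegion 1 (Real.pi / 2)))
    (hΦb : ∀ w ∈ Literature.Analysis.Complex.sectorRegion 1 (Real.pi / 2), ‖Φ w‖ ≤ M)
    (hΦr : ∀ u : Fin 2 → ℝ, (∀ j, 0 < u j) →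
      Φ (fun j => (u j : ℂ)) = S (m + m) ((osAdjoint G).appendTensor
        (translateMulti (((u 0 + u 1) / Real.sqrt 2) • EuclideanSpace.single 0 1 +
          ((u 0 - u 1) / Real.sqrt 2) • EuclideanSpace.single 1 1) G))) :
    ∀ t : ℝ, 0 < t → ∃ f : ℂ → ℂ, DifferentiableOn ℂ f (Metric.ball 0 t) ∧
      (∀ z ∈ Metric.ball (0 : ℂ) t, ‖f z‖ ≤ M) ∧
      ∀ b : ℝ, |b| < t → f b = ⟪h.fieldVec m (fun _ => ()) G hG,
        h.transfer t (h.translate (b • EuclideanSpace.single 1 1) (h.fieldVec m (fun _ => ()) G hG))⟫_ℂ := by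
  sorry

/-- **BACK END, the lever — disc sections with a `t`-uniform bound force the cone (M; pure measure theory).**
A finite positive measure `μ` on energy–momentum space `ℝ⁴` carried by `{p₀ ≥ 0}` whose Fourier–Laplace
sections `b ↦ ∫ e^{−tp₀ + ibp₁} dμ` are, for every `t > 0`, restrictions to `(−t,t)` of functions holomorphic
on the disc `|β| < t` and bounded there by ONE constant `M`, charges nothing outside the closed planar cone:
`μ{p₀ < |p₁|} = 0`.
Why true: (1) Lukacs, Characteristic Functions (2nd ed.), Thm 7.1.1 / Landau–Pringsheim: for the finite measure
`ν_t = (p ↦ p₁)_*(e^{−tp₀}μ)` on `ℝ` the characteristic function agrees on `(−t,t)` with `f` holomorphic on the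
disc, so by induction on `k` (Fatou on the symmetric second difference quotients
`(f(h)+f(−h)−2f(0))/h² = −∫(2 sin(hx/2)/h)² dν`) all even moments exist with `∫x^{2k}dν_t = (−1)ᵏ f^{(2k)}(0)`,
and the Cauchy estimates `|f^{(2k)}(0)| ≤ M (2k)!/r^{2k}` (`r < t`) give
`∫ cosh(σ x) dν_t = Σₖ σ^{2k}/(2k)! ∫x^{2k}dν_t ≤ M Σ (σ/r)^{2k} < ∞` for `|σ| < r`; hence
`F(β) = ∫ e^{iβx} dν_t` is holomorphic on the strip `|Im β| < t`, equals `f` on the disc (identity theorem from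
the real segment), and `∫ e^{−tp₀ − σp₁} dμ = F(iσ) = f(iσ)`, `|f(iσ)| ≤ M` for `|σ| < t`.
(2) Ray asymptotics (cdisprove `cone_of_laplace_bound`, proved in Disproof.lean v3): on
`A_{κ,δ} = {κ p₁ − p₀ > δ}` (`0 < κ < 1`, `δ > 0`; there `p₁ > 0`) the choice `σ = −κt` gives integrand
`e^{t(κp₁−p₀)} ≥ e^{tδ}`, so `e^{tδ} μ(A_{κ,δ}) ≤ M` for all `t`, i.e. `μ(A_{κ,δ}) = 0`; symmetrically for `−p₁`
with `σ = κt`; `{p₀ < |p₁|} ⊆ {p₀ < 0} ∪ ⋃ₙ (A_{1−1/n,1/n} ∪ A'_{1−1/n,1/n})` is null (`measure_iUnion_null`).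
Size M (Lukacs is not in Mathlib). -/
theorem stub_cone_of_discSections (μ : Measure E4) [IsFiniteMeasure μ]
    (hE : μ {p | p 0 < 0} = 0) (M : ℝ)
    (hdisc : ∀ t : ℝ, 0 < t → ∃ f : ℂ → ℂ,
      DifferentiableOn ℂ f (Metric.ball 0 t) ∧
        (∀ z ∈ Metric.ball (0 : ℂ) t, ‖f z‖ ≤ M) ∧
          ∀ b : ℝ, |b| < t →
            f b = ∫ p, Complex.exp ((((-(t * p 0) : ℝ)) : ℂ) + ((b * p 1 : ℝ) : ℂ) * Complex.I) ∂μ) :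
    μ {p | p 0 < |p 1|} = 0 := by
  sorry

/-- **CLOSURE / LINEARITY — null sets of joint spectral measures pass to the closed span (M).** For ANY
labelled family with E2 and translation invariance on `⁰𝒮` (any labels, any dimension), a Borel set `N` of
energy–momentum space that is null for every joint spectral measure of every vector of a set `D` of dense
linear span is null for every joint spectral measure of every vector.
Why true: joint spectral measures EXIST (`OSReconstructionNoE1.exists_isJointSpectralMeasure_holds`, proved)
and are UNIQUE — a finite measure `μ` on `{p₀ ≥ 0}` is determined by `g(t,a) = ∫ e^{−tp₀ + i⟨a,p⟩} dμ`,
`t ≥ 0`, `a ⊥ e₀`: for fixed `ξ ∈ ℝ^d`, `z ↦ ∫ e^{−z p₀ + i⟨ξ⃗,p⃗⟩} dμ` is holomorphic on `Re z > 0`,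
continuous on `Re z ≥ 0` and bounded by `μ(univ)`, so two such measures with the same `g` have transforms
agreeing on `(0,∞)`, hence on `Re z > 0` (identity theorem, `AnalyticOnNhd.eqOn_of_preconnected_of_frequently_eq`),
hence at `z = −iξ₀` (continuity), i.e. equal characteristic functions `∫ e^{i⟨ξ,p⟩}dμ` — Mathlib
`MeasureTheory.Measure.ext_of_charFun`. With uniqueness, `μ_{cψ} = |c|²μ_ψ` and the parallelogram law
`μ_{ψ+φ} + μ_{ψ−φ} = 2μ_ψ + 2μ_φ` hold AS MEASURES (both sides are joint spectral measures / have the same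
transform, by expanding `⟪ψ±φ, W(ψ±φ)⟫`), so `V = {ψ | μ_ψ(N) = 0}` is closed under scalars and sums
(`μ_{ψ+φ}(N) ≤ 2μ_ψ(N) + 2μ_φ(N)`), and CLOSED: `μ_ψ(N) ≤ 2μ_{ψₙ}(N) + 2μ_{ψ−ψₙ}(N) ≤ 2‖ψ − ψₙ‖² → 0`
(`measureReal_univ`). `D ⊆ V` ⇒ `span D ⊆ V` ⇒ `closure = ⊤ ⊆ V`. Size M. -/
theorem stub_linearity {ι : Type*} {d : ℕ} [NeZero d]
    {S : LabelledSchwingerFamily ι (EuclideanSpace ℝ (Fin d))} (h : OSReconstructionNoE1 S)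
    {N : Set (EuclideanSpace ℝ (Fin d))} (hN : MeasurableSet N) {D : Set h.Hilbert}
    (hD : Dense ((Submodule.span ℂ D : Submodule ℂ h.Hilbert) : Set h.Hilbert))
    (hDN : ∀ ψ ∈ D, ∀ μ : Measure (EuclideanSpace ℝ (Fin d)), h.IsJointSpectralMeasure ψ μ → μ N = 0)
    (ψ : h.Hilbert) (μ : Measure (EuclideanSpace ℝ (Fin d))) (hμ : h.IsJointSpectralMeasure ψ μ) :
    μ N = 0 := by
  sorry

/-- **TRANSFER C⁺ ⇒ C — the holomorphic contraction family on the operator cone (L).** For ANY labelled family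
`T` on `ℝ⁴` with E2 + translations: if EVERY joint spectral measure of EVERY vector is carried by the closed
planar cone `{p₀ ≥ |p₁|}` (operator cone `H ≥ |P₁|`), then for `ψ, ψ'` there is `Φ` holomorphic on
`D = {(ζ,β) : |Im β| < Re ζ}` with `Φ(t,b) = ⟪ψ, e^{-tH} U(b e₁) ψ'⟫` (`t > 0`, `b ∈ ℝ`) and `|Φ| ≤ ‖ψ‖‖ψ'‖`
on `D` — i.e. `⟪ψ, e^{−ζH + iβP₁}ψ'⟫` as a contraction family, WITHOUT an unbounded functional calculus.
Why true (two routes, both available under the global hypothesis):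
(a) forms + identity theorem: `Q_w(χ) = ∫ e^{−ζp₀+iβp₁} dμ_χ` (any joint spectral measure; holomorphic on `D`
by dominated differentiation since `|e^{−ζp₀+iβp₁}| ≤ e^{−(Re ζ−|Im β|)p₀} ≤ 1` on the cone; `|Q_w(χ)| ≤ ‖χ‖²`;
`= ⟪χ, e^{-tH}U(be₁)χ⟫` at real points), `B_w(ψ,ψ') = ¼Σ(−i)ᵏ Q_w(ψ + iᵏψ')`: at real `w` it is
`⟪ψ, e^{-tH}U(be₁)ψ'⟫` (polarisation), so by the identity theorem on `D` from the real points
(one variable at a time: `ζ` on `{Re ζ > |Im b|}` then `β` on the strip) `B_w` is sesquilinear, bounded by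
`‖ψ‖² + ‖ψ'‖²` hence (scaling) by `2‖ψ‖‖ψ'‖`, represented by `T_w ∈ B(ℋ)` (`continuousLinearMapOfBilin`);
the same identity-theorem argument gives `T_w* = T_{w♯}`, `w♯ = (ζ̄, −β̄)`, and `T_{w₁+w₂} = T_{w₁}T_{w₂}`
(true at real points: self-adjointness of `e^{-tH}`, unitarity, `translate_transfer`, `transfer_add`,
`translate_add_apply`), whence `‖T_wψ'‖² = ⟪ψ', T_{w♯+w}ψ'⟫ = ∫ e^{−2Re ζ p₀ − 2Im β p₁} dμ_ψ' ≤ ‖ψ'‖²` and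
`|Φ(w)| = |⟪ψ, T_wψ'⟫| ≤ ‖ψ‖‖ψ'‖`;
(b) Kolmogorov: the isometry `J_χ : closure span{e^{−tp₀+i⟨a,p⟩}} ⊆ L²(μ_χ) → ℋ`, `e_{t,a} ↦ e^{-tH}U(a)χ`
(Gram identity by `inner_transfer_translate`), `Φ(w) = ⟪J_ψ f_{w♯/2}, J_ψ' f_{w/2}⟫`, `f_w = e^{−ζp₀+iβp₁}`.
Size L. -/
theorem stub_contractionFamily
    {ι : Type} {T : LabelledSchwingerFamily ι E4} (h : OSReconstructionNoE1 T)
    (hcone : ∀ (ψ : h.Hilbert) (μ : Measure E4), h.IsJointSpectralMeasure ψ μ → μ {p | p 0 < |p 1|} = 0)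
    (ψ ψ' : h.Hilbert) :
    ∃ Φ : ℂ × ℂ → ℂ, DifferentiableOn ℂ Φ {w : ℂ × ℂ | |w.2.im| < w.1.re} ∧
      (∀ t b : ℝ, 0 < t → Φ ((t : ℂ), (b : ℂ)) =
        ⟪ψ, h.transfer t (h.translate (b • EuclideanSpace.single 1 1) ψ')⟫_ℂ) ∧
      ∀ w ∈ {w : ℂ × ℂ | |w.2.im| < w.1.re}, ‖Φ w‖ ≤ ‖ψ‖ * ‖ψ'‖ := by
  sorry

/-- **DENSITY — cone-chain field vectors are total (hardest; L).** In the e₀-frame reconstruction `h` of a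
family `S` with E0' and E3, a vector orthogonal to `Ψ_G` for every cone chain `G` (every arity `m`, including
`m = 0`: the vacuum) is zero.
Why plausibly true (card `cone-ordered-density-holomorphic-gaps`): ℋ is the closed span of the `Ψ_G`,
`G` time-ordered (`denseRange_vec`); `G ↦ Ψ_G` is continuous from 𝒮, so reduce to compactly supported `G`, then
(tensor products are dense in `C_c^∞` of a product of windows) to products `g₁⊗⋯⊗g_m` with time windows
`I₁ < ⋯ < I_m`; stretching the gaps, `G^{(s)} = g₁^{s₁e₀} ⊗ g₂^{(s₁+s₂)e₀} ⊗ ⋯`, gives cone chains for all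
`s_k ≥ s₀`; in each `s_k` separately, re-centring the e₀ mirror inside gap `k` (translation invariance on ⁰𝒮)
writes `𝔖(ΘA* ⊗ G^{(s)}) = ⟪Ψ_{A_k}, e^{-s_kH}Ψ_{B_k}⟫`, so the Gram kernel is m-slot sector data with
polynomial slot growth (temperedness of `𝔖_{2m}`), jointly sesqui-holomorphic near `(0,∞)^m`
(`IsSectorData.exists_extension`, p ≥ 0), and `exists_holomorphic_gramVec` (OSHolomorphicVectors) produces a
holomorphic ℋ-valued `s ↦ Ψ(s)` through the real vectors; `s ↦ ⟪χ, Ψ(s)⟫` vanishes on the open real set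
`{s_k > s₀}` hence identically, and `s → 0⁺` gives `⟪χ, Ψ_G⟫ = 0`. Size L. -/
theorem stub_coneChain_dense
    (S : SchwingerFamily E4) (hE0' : S.toLabelled.HasLinearGrowth) (hE3 : S.toLabelled.IsSymmetric)
    (h : OSReconstructionNoE1 S.toLabelled) (χ : h.Hilbert)
    (hχ : ∀ (m : ℕ) (G : SchwartzMap (Fin m → E4) ℂ) (hG : IsTimeOrdered G),
      tsupport (G : (Fin m → E4) → ℂ) ⊆
        {x | (∀ i, |x i 1| < x i 0) ∧ ∀ i j, i < j → |x j 1 - x i 1| < x j 0 - x i 0} →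
      ⟪χ, h.fieldVec m (fun _ => ()) G hG⟫_ℂ = 0) :
    χ = 0 := by
  sorry

/-! ## Glue (sorry-free) -/

/-- `linActMulti` of the identity frame is the identity. [bookkeeping] -/
theorem linActMulti_refl_comp (S : SchwingerFamily E4) :
    (fun k => (S k).comp (linActMulti (LinearIsometryEquiv.refl ℝ E4))) = S := by
  funext k
  refine ContinuousLinearMap.ext fun F => ?_
  have hF : linActMulti (LinearIsometryEquiv.refl ℝ E4) F = F := by
    ext x
    exact linActMulti_apply _ F x
  rw [ContinuousLinearMap.comp_apply, hF]

/-- Time-then-space translation is the single translation by `t e₀ + b e₁`. [bookkeeping] -/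
theorem translateMulti_time_space {m : ℕ} (t b : ℝ) (G : SchwartzMap (Fin m → E4) ℂ) :
    translateMulti (SchwingerFamily.timeVec t)
        (translateMulti (spatialPart 0 (b • (EuclideanSpace.single 1 1 : E4))) G) =
      translateMulti (t • EuclideanSpace.single 0 1 + b • EuclideanSpace.single 1 1) G := by
  have hv : (SchwingerFamily.timeVec t + spatialPart 0 (b • (EuclideanSpace.single 1 1 : E4)) : E4) =
      t • EuclideanSpace.single 0 1 + b • EuclideanSpace.single 1 1 := by
    ext i
    fin_cases i <;> simp [SchwingerFamily.timeVec, spatialPart_apply]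
  rw [translateMulti_translateMulti, hv]

/-- **Read-back of a translated diagonal pairing**: for a time-ordered `B` in the OS space of a labelled
one-species family `T = S'.toLabelled`, `𝔖'_{2m}(ΘA* ⊗ B_{t e₀ + b e₁}) = ⟪Ψ_A, e^{-tH} U(b e₁) Ψ_B⟫` (`t ≥ 0`).
[bookkeeping] -/
theorem pairing_eq_inner_transfer_translate (S' : SchwingerFamily E4) (h' : OSReconstructionNoE1 S'.toLabelled)
    {n m : ℕ} (A : SchwartzMap (Fin n → E4) ℂ) (B : SchwartzMap (Fin m → E4) ℂ)
    (hA : IsTimeOrdered A) (hB : IsTimeOrdered B) {t : ℝ} (ht : 0 ≤ t) (b : ℝ) :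
    S' (n + m) ((osAdjoint A).appendTensor
        (translateMulti (t • EuclideanSpace.single 0 1 + b • EuclideanSpace.single 1 1) B)) =
      ⟪h'.fieldVec n (fun _ => ()) A hA,
        h'.transfer t (h'.translate (b • EuclideanSpace.single 1 1) (h'.fieldVec m (fun _ => ()) B hB))⟫_ℂ := by
  rw [OSReconstructionNoE1.translate_fieldVec, OSReconstructionNoE1.transfer_fieldVec _ ht]
  have hH : IsAppendTensorOf ((osAdjoint A).appendTensor
      (translateMulti (t • EuclideanSpace.single 0 1 + b • EuclideanSpace.single 1 1) B)) (osAdjoint A)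
      (translateMulti (SchwingerFamily.timeVec t)
        (translateMulti (spatialPart 0 (b • (EuclideanSpace.single 1 1 : E4))) B)) := by
    rw [translateMulti_time_space]; exact isAppendTensorOf_appendTensor _ _
  rw [h'.inner_fieldVec_fieldVec (fun _ => ()) (fun _ => ()) hA _ hH]
  rfl

/-- **FRONT END assembled — two-slot sector data of a cone chain.** From `stub_coneChainFrames` (geometry) and
`stub_complexTimeSlot` (analysis, applied in the two pulled-back reconstructions) the function
`φ_G(u,u') = 𝔖_{2m}(ΘG* ⊗ G_{a(u,u')})` with its two diagonal-semigroup slots is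
`LogSlot.IsSectorData (π/2) φ_G E M 0 (fun _ => M)`; the base bound `‖φ_G‖ ≤ ‖Ψ_G‖²` is read in the e₀ frame. -/
theorem coneSectorData
    (S : SchwingerFamily E4)
    (hT : ∀ (n : ℕ) (a : E4) (F : SchwartzMap (Fin n → E4) ℂ), IsOffDiagonal F →
      S n (translateMulti a F) = S n F)
    (hRP : ∀ (R : E4 ≃ₗᵢ[ℝ] E4) (a b : ℝ), a ^ 2 + b ^ 2 = 1 → (a = 0 ∨ b = 0 ∨ a ^ 2 = b ^ 2) →
      R (EuclideanSpace.single 0 1) = a • EuclideanSpace.single 0 1 + b • EuclideanSpace.single 1 1 →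
      (SchwingerFamily.toLabelled (fun n => (S n).comp (linActMulti R))).IsReflectionPositive)
    (h : OSReconstructionNoE1 S.toLabelled)
    {m : ℕ} (G : SchwartzMap (Fin m → E4) ℂ) (hG : IsTimeOrdered G)
    (hGcone : tsupport (G : (Fin m → E4) → ℂ) ⊆
      {x | (∀ i, |x i 1| < x i 0) ∧ ∀ i j, i < j → |x j 1 - x i 1| < x j 0 - x i 0}) :
    ∃ (M : ℝ) (E : Fin 2 → (Fin 1 → ℝ) → ℂ → ℂ),
      LogSlot.IsSectorData (Real.pi / 2)
        (fun u : Fin 2 → ℝ => S (m + m) ((osAdjoint G).appendTensor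
          (translateMulti (((u 0 + u 1) / Real.sqrt 2) • EuclideanSpace.single 0 1 +
            ((u 0 - u 1) / Real.sqrt 2) • EuclideanSpace.single 1 1) G)))
        E M 0 (fun _ => M) := by
  obtain ⟨Rp, Rm, Ap, Bp, Am, Bm, hAp, hBp, hAm, hBm, hp, hm, hidp, hidm⟩ :=
    stub_coneChainFrames S hT hRP G hGcone
  -- the two pulled-back reconstructions and their complex-time slots
  obtain ⟨Cp, Ep, hEpd, hEpc, hEpb, hEpr⟩ :=
    stub_complexTimeSlot hp (hp.fieldVec m (fun _ => ()) Ap hAp) (hp.fieldVec m (fun _ => ()) Bp hBp)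
  obtain ⟨Cm, Em, hEmd, hEmc, hEmb, hEmr⟩ :=
    stub_complexTimeSlot hm (hm.fieldVec m (fun _ => ()) Am hAm) (hm.fieldVec m (fun _ => ()) Bm hBm)
  set ψG := h.fieldVec m (fun _ => ()) G hG with hψG
  set M : ℝ := max (‖ψG‖ ^ 2) (max Cp Cm) with hM
  set Sfun : (Fin 2 → ℝ) → ℂ := fun u => S (m + m) ((osAdjoint G).appendTensor
    (translateMulti (((u 0 + u 1) / Real.sqrt 2) • EuclideanSpace.single 0 1 +
      ((u 0 - u 1) / Real.sqrt 2) • EuclideanSpace.single 1 1) G)) with hSfun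
  set E : Fin 2 → (Fin 1 → ℝ) → ℂ → ℂ :=
    ![fun u' τ => Ep ((-(u' 0)) • EuclideanSpace.single 1 1) τ,
      fun u' τ => Em ((u' 0) • EuclideanSpace.single 1 1) τ] with hE
  have hM0 : 0 ≤ M := le_trans (by positivity) (le_max_left _ _)
  have hs2 : 0 < Real.sqrt 2 := Real.sqrt_pos.2 two_pos
  -- base values in the e₀ frame
  have hbase : ∀ u : Fin 2 → ℝ, (∀ j, 0 < u j) → ‖Sfun u‖ ≤ ‖ψG‖ ^ 2 := by
    intro u hu
    have ht : 0 ≤ (u 0 + u 1) / Real.sqrt 2 := by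
      have := hu 0; have := hu 1; positivity
    have e := pairing_eq_inner_transfer_translate S h G G hG hG ht ((u 0 - u 1) / Real.sqrt 2)
    simp only [hSfun]
    rw [e]
    calc ‖⟪ψG, h.transfer ((u 0 + u 1) / Real.sqrt 2)
            (h.translate (((u 0 - u 1) / Real.sqrt 2) • EuclideanSpace.single 1 1) ψG)⟫_ℂ‖
        ≤ ‖ψG‖ * ‖h.transfer ((u 0 + u 1) / Real.sqrt 2)
            (h.translate (((u 0 - u 1) / Real.sqrt 2) • EuclideanSpace.single 1 1) ψG)‖ :=
          norm_inner_le_norm _ _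
      _ ≤ ‖ψG‖ * ‖ψG‖ := by
          gcongr
          refine (h.norm_transfer_le _ _).trans ?_
          rw [LinearIsometryEquiv.norm_map]
      _ = ‖ψG‖ ^ 2 := by ring
  -- real values of the two slots
  have hreal_p : ∀ (x y : ℝ), 0 < x →
      Ep ((-y) • EuclideanSpace.single 1 1) (x : ℂ) = Sfun ![x, y] := by
    intro x y hx
    rw [hEpr _ (by simp) x hx]
    simp only [hSfun, Matrix.cons_val_zero, Matrix.cons_val_one]
    rw [hidp x y]
    exact (pairing_eq_inner_transfer_translate (fun k => (S k).comp (linActMulti Rp)) hp Ap Bp hAp hBp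
      hx.le (-y)).symm
  have hreal_m : ∀ (x y : ℝ), 0 < x →
      Em (y • EuclideanSpace.single 1 1) (x : ℂ) = Sfun ![y, x] := by
    intro x y hx
    rw [hEmr _ (by simp) x hx]
    simp only [hSfun, Matrix.cons_val_zero, Matrix.cons_val_one]
    rw [hidm y x]
    exact (pairing_eq_inner_transfer_translate (fun k => (S k).comp (linActMulti Rm)) hm Am Bm hAm hBm
      hx.le y).symm
  refine ⟨M, E, ?_, hM0, ?_, ?_, ?_, fun _ => hM0, ?_, ?_⟩
  · -- continuity of φ_G on the open quadrant (translations are continuous on 𝒮)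
    have hc := OSReconstructionNoE1.continuous_apply_appendTensor_translateMulti S.toLabelled
      ⟨m, fun _ => (), G, hG⟩ ⟨m, fun _ => (), G, hG⟩
    have hv : Continuous fun u : Fin 2 → ℝ =>
        (((u 0 + u 1) / Real.sqrt 2) • EuclideanSpace.single 0 1 +
          ((u 0 - u 1) / Real.sqrt 2) • EuclideanSpace.single 1 1 : E4) := by fun_prop
    exact (hc.comp hv).continuousOn
  · intro u hu
    rw [pow_zero, mul_one]
    exact (hbase u hu).trans (le_max_left _ _)
  · intro i τ hτ
    fin_cases i
    · simp only [hE, Fin.zero_eta, Fin.isValue, Matrix.cons_val_zero]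
      exact ((hEpc τ hτ.1).comp (by fun_prop)).continuousOn
    · simp only [hE, Fin.mk_one, Fin.isValue, Matrix.cons_val_one, Matrix.cons_val_fin_one]
      exact ((hEmc τ hτ.1).comp (by fun_prop)).continuousOn
  · intro i u' hu'
    fin_cases i
    · simpa [hE] using (hEpd _).mono fun τ hτ => hτ.1
    · simpa [hE] using (hEmd _).mono fun τ hτ => hτ.1
  · intro i c _ u' τ hu' hτ _
    rw [pow_zero, pow_zero, mul_one, mul_one]
    fin_cases i
    · have := hEpb ((-(u' 0)) • EuclideanSpace.single 1 1) τ hτ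
      simp only [hE, Fin.zero_eta, Fin.isValue, Matrix.cons_val_zero]
      exact this.trans ((le_max_left _ _).trans (le_max_right _ _))
    · have := hEmb ((u' 0) • EuclideanSpace.single 1 1) τ hτ
      simp only [hE, Fin.mk_one, Fin.isValue, Matrix.cons_val_one, Matrix.cons_val_fin_one]
      exact this.trans ((le_max_right _ _).trans (le_max_right _ _))
  · intro i u' hu' x hx
    fin_cases i
    · simp only [hE, Fin.zero_eta, Fin.isValue, Matrix.cons_val_zero]
      rw [hreal_p x (u' 0) hx]
      congr 1
      funext j
      fin_cases j
      · simp
      · simp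
    · simp only [hE, Fin.mk_one, Fin.isValue, Matrix.cons_val_one, Matrix.cons_val_fin_one]
      rw [hreal_m x (u' 0) hx]
      have h0 : (1 : Fin 2).succAbove (0 : Fin 1) = 0 := by decide
      have h0' : Fin.insertNth (α := fun _ : Fin 2 => ℝ) (1 : Fin 2) x u' 0 = u' 0 := by
        conv_lhs => rw [← h0]
        rw [Fin.insertNth_apply_succAbove]
      congr 1
      funext j
      fin_cases j
      · simp [h0']
      · simp

/-- `⟪b e₁, p⟫ = b p₁`. [bookkeeping] -/
theorem inner_smul_single_one (b : ℝ) (p : E4) :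
    ⟪(b • EuclideanSpace.single 1 1 : E4), p⟫_ℝ = b * p 1 := by
  simp [inner_smul_left, EuclideanSpace.inner_single_left]

/-- The complement of the closed planar cone is Borel. [bookkeeping] -/
theorem measurableSet_coneCompl : MeasurableSet {p : E4 | p 0 < |p 1|} := by
  have h0 : Continuous fun p : E4 => p 0 := by fun_prop
  have h1 : Continuous fun p : E4 => |p 1| := by fun_prop
  exact (isOpen_lt h0 h1).measurableSet

/-- **The composition (kernel-checked, no `sorry` of its own): the seven stubs prove the crux
`MirrorModularBoosts.PlanarSpectralCone` BY NAME.** -/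
theorem PlanarSpectralCone_of : PlanarSpectralCone := by
  intro S hE0' hE3 hT hRP n m F G hF hG
  -- Step 0: the e₀-frame Osterwalder–Schrader reconstruction (frame hypothesis at `R = 1`, `(a,b) = (1,0)`).
  have hRP0 : S.toLabelled.IsReflectionPositive := by
    have h1 := hRP (LinearIsometryEquiv.refl ℝ E4) 1 0 (by norm_num) (Or.inr (Or.inl rfl)) (by simp)
    rwa [linActMulti_refl_comp S] at h1
  have hTI : S.toLabelled.IsTranslationInvariant := fun k _ a F' hF' => hT k a F' hF'
  have h : OSReconstructionNoE1 S.toLabelled := ⟨hRP0, hTI⟩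
  -- Step 1: every joint spectral measure of a cone-chain vector is coned
  -- (frames + slots ⇒ sector data; tree engine with the sharp maximum principle; Thales; the lever).
  have hcone : ∀ (m' : ℕ) (G' : SchwartzMap (Fin m' → E4) ℂ) (hG' : IsTimeOrdered G'),
      tsupport (G' : (Fin m' → E4) → ℂ) ⊆
        {x | (∀ i, |x i 1| < x i 0) ∧ ∀ i j, i < j → |x j 1 - x i 1| < x j 0 - x i 0} →
      ∀ μ : Measure E4, h.IsJointSpectralMeasure (h.fieldVec m' (fun _ => ()) G' hG') μ →
        μ {p | p 0 < |p 1|} = 0 := by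
    intro m' G' hG' hcc μ hμ
    obtain ⟨M, Esl, hdata⟩ := coneSectorData S hT hRP h G' hG' hcc
    obtain ⟨Φ, hΦd, hΦr⟩ := hdata.exists_extension (by positivity) le_rfl
    have hΦb : ∀ w ∈ Literature.Analysis.Complex.sectorRegion 1 (Real.pi / 2), ‖Φ w‖ ≤ M := by
      intro w hw
      obtain ⟨c, hc1, hc2⟩ := exists_between hw.2
      have hc0 : 0 < c := lt_of_le_of_lt (Finset.sum_nonneg fun j _ => abs_nonneg _) hc1
      exact hdata.norm_extension_le le_rfl hΦd hΦr hc0 hc2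
        (fun u hu => by simpa using hdata.bound u hu)
        (fun i u' τ hu' hτ hτc => by simpa using hdata.slot_bound i c hc2 u' τ hu' hτ hτc)
        ⟨hw.1, hc1⟩
    have hdisc := stub_discSections_of_sectorExtension S h G' hG' M Φ hΦd hΦb hΦr
    haveI := hμ.isFiniteMeasure
    refine stub_cone_of_discSections μ hμ.energy_nonneg M fun t ht => ?_
    obtain ⟨f, hf, hfM, hfb⟩ := hdisc t ht
    refine ⟨f, hf, hfM, fun b hb => ?_⟩
    rw [hfb b hb, hμ.inner_transfer_translate t ht.le (b • EuclideanSpace.single 1 1) (by simp)]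
    simp_rw [inner_smul_single_one]
  -- Step 2: every joint spectral measure of every vector is coned (density + linearity).
  set Dset : Set h.Hilbert := {k | ∃ (m' : ℕ) (G' : SchwartzMap (Fin m' → E4) ℂ) (hG' : IsTimeOrdered G'),
      tsupport (G' : (Fin m' → E4) → ℂ) ⊆
        {x | (∀ i, |x i 1| < x i 0) ∧ ∀ i j, i < j → |x j 1 - x i 1| < x j 0 - x i 0} ∧
      k = h.fieldVec m' (fun _ => ()) G' hG'} with hDset
  have hdense : Dense ((Submodule.span ℂ Dset : Submodule ℂ h.Hilbert) : Set h.Hilbert) := by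
    rw [Submodule.dense_iff_topologicalClosure_eq_top, Submodule.topologicalClosure_eq_top_iff,
      Submodule.eq_bot_iff]
    intro χ hχ
    refine stub_coneChain_dense S hE0' hE3 h χ fun m' G' hG' hcc => ?_
    have hk : h.fieldVec m' (fun _ => ()) G' hG' ∈ Submodule.span ℂ Dset :=
      Submodule.subset_span ⟨m', G', hG', hcc, rfl⟩
    rw [← inner_conj_symm, Submodule.inner_right_of_mem_orthogonal hk hχ, map_zero]
  have hall : ∀ (ψ : h.Hilbert) (μ : Measure E4), h.IsJointSpectralMeasure ψ μ → μ {p | p 0 < |p 1|} = 0 := by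
    intro ψ μ hμ
    refine stub_linearity h measurableSet_coneCompl hdense ?_ ψ μ hμ
    rintro k ⟨m', G', hG', hcc, rfl⟩ μ' hμ'
    exact hcone m' G' hG' hcc μ' hμ'
  -- Step 3: the contraction family of (Ψ_F, Ψ_G), read back as Schwinger functions.
  obtain ⟨Φ, hΦd, hΦr, hΦb⟩ := stub_contractionFamily h hall (h.fieldVec n (fun _ => ()) F hF)
    (h.fieldVec m (fun _ => ()) G hG)
  refine ⟨Φ, hΦd, ?_, ?_⟩
  · intro t b ht H hH
    rw [hΦr t b ht, OSReconstructionNoE1.translate_fieldVec, OSReconstructionNoE1.transfer_fieldVec _ ht.le]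
    have hH' : IsAppendTensorOf H (osAdjoint F) (translateMulti (SchwingerFamily.timeVec t)
        (translateMulti (spatialPart 0 (b • (EuclideanSpace.single 1 1 : E4))) G)) := by
      rw [translateMulti_time_space]; exact hH
    rw [h.inner_fieldVec_fieldVec (fun _ => ()) (fun _ => ()) hF _ hH']
    rfl
  · intro w hw HF HG hHF hHG
    have hb := hΦb w hw
    have hsq : ∀ {k : ℕ} (A : SchwartzMap (Fin k → E4) ℂ) (hA : IsTimeOrdered A)
        (HA : SchwartzMap (Fin (k + k) → E4) ℂ), IsAppendTensorOf HA (osAdjoint A) A →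
        ‖S (k + k) HA‖ = ‖h.fieldVec k (fun _ => ()) A hA‖ ^ 2 := by
      intro k A hA HA hHA
      have e := h.inner_fieldVec_fieldVec (fun _ => ()) (fun _ => ()) hA hA hHA
      rw [show S (k + k) HA = ⟪h.fieldVec k (fun _ => ()) A hA, h.fieldVec k (fun _ => ()) A hA⟫_ℂ from e.symm,
        inner_self_eq_norm_sq_to_K, norm_pow, RCLike.norm_ofReal, abs_norm]
    rw [hsq F hF HF hHF, hsq G hG HG hHG, ← mul_pow]
    exact pow_le_pow_left₀ (norm_nonneg _) hb 2

end Summit.QuantumFields.YangMills.Cruxes.PlanarSpectralCone.TwoMirrorLightconeSlots
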